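import Literature.Computability.Complexity.CanonicalCodes
import Literature.Barriers.CriticalPhenomena.GridSAWCountingVerifier
import HarnessLib

/-!
# Barrier `GridSAWCountingSharpPComplete`, tower step (T3, part A): the canonicaliser of
# drawn-graph instance codes is polynomial time

Sibling of `GridSAWCountingViaGridHamPath.lean` (the pivot `GRIDHAMPATHCOUNT` on codes of
`(P, D, s, t)`, `encodingDrawnGraphInstance` = `pointList × (drawnEdgeList × (ℕ × ℕ))`, a drawn
edge being `ℕ × ℕ × pointList`), `GridSAWDrawingChecker.lean` (T3-B: validity of a drawing decided
on CANONICAL codes) and `GridSAWCountingVerifier.lean` (`decPoint`, `decWalk`, `canonPointFn`). An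
`FP` instance map for `LOT2003_thm7_fixedLength_towers` first re-encodes its input canonically, so
that the checker and the construction only ever see `encode` of the decoded instance; since a drawn
edge CONTAINS a list (its path), the list of drawn edges is a NESTED list code and needs the clipped
canonicaliser `CanonCode.canonListFnC` (`CanonicalCodes.lean`), whose item map may be linearly
bounded. This file assembles:

* total decoders `decDrawnEdge`, `decDrawnEdgeList`, `decDrawnGraph` (the values of the tree's
  decoders, which never fail: `decode_drawnEdge`, …, `decode_drawnGraph`);
* `canonPathFn` (= `canonListFnC 18 canonPointFn`, value `walkCode ∘ decWalk`, size `≤ 20|u| + 2`),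
  `canonDrawnEdgeFn` (size `≤ 22|u| + 10`), `canonDrawnEdgeListFn` (= `canonListFnC 32 …`),
  **`canonDrawnGraphFn`** with `canonDrawnGraphFn_eq : canonDrawnGraphFn w = encode (decDrawnGraph w)`
  and **`canonDrawnGraphFn_mem_FP`**.

## References

* M. Liśkiewicz, M. Ogihara, S. Toda, *The complexity of counting self-avoiding walks in
  subgraphs of two-dimensional grids and hypercubes*, TCS 304 (2003), §4 (proof of Theorem 7).
* S. Arora, B. Barak, *Computational Complexity: A Modern Approach*, CUP 2009, §0.1, §1.3.
-/

noncomputable section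

namespace Literature.Barriers.CriticalPhenomena.GridSAW

open _root_.Computability Literature.Computability.Complexity Literature.Computability.Complexity.Brick
  Literature.Computability.Complexity.CanonCode

/-! ### Paths (point lists) -/

/-- **Canonicalisation of point-list codes** (paths, vertex lists), clipped so that it can be
nested: `canonListFnC 18 canonPointFn`. [folklore] -/
def canonPathFn : List Bool → List Bool := canonListFnC 18 canonPointFn

/-- `canonPathFn ∈ FP`. [folklore] -/
theorem canonPathFn_mem_FP : canonPathFn ∈ FP := canonListFnC_mem_FP 18 canonPointFn_mem_FP

/-- The additive bound of `canonPointFn` in linear form. [folklore] -/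
theorem length_canonPointFn_le' (u : List Bool) : (canonPointFn u).length ≤ 1 * u.length + 17 := by
  have := length_canonPointFn_le u; omega

/-- **`canonPathFn` re-encodes the decoded point list.** [folklore] -/
theorem canonPathFn_eq (u : List Bool) : canonPathFn u = walkCode (decWalk u) :=
  (canonListFnC_eq _ decPoint decode_point canonPointFn_eq length_canonPointFn_le' (by norm_num) u).2

/-- The point-list decoder is total with value `decWalk`. [folklore] -/
theorem decode_pointList (u : List Bool) : encodingGridPoint.listBool.decode u = some (decWalk u) :=
  (canonListFnC_eq _ decPoint decode_point canonPointFn_eq length_canonPointFn_le' (by norm_num : 1 + 17 ≤ 18) u).1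

/-- `|canonPathFn u| ≤ 20 |u| + 2`. [folklore] -/
theorem length_canonPathFn_le (u : List Bool) : (canonPathFn u).length ≤ 20 * u.length + 2 := by
  have := length_canonListFnC_le (C := 18) length_canonPointFn_le' (by norm_num) u
  rw [canonPathFn]; omega

/-! ### Drawn edges -/

/-- The drawn edge read off any string. [folklore] -/
def decDrawnEdge (u : List Bool) : DrawnEdge :=
  (decodeNat (boolUnpair u).1, decodeNat (boolUnpair (boolUnpair u).2).1, decWalk (boolUnpair (boolUnpair u).2).2)

/-- **Canonicalisation of drawn-edge codes.** [folklore] -/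
def canonDrawnEdgeFn : List Bool → List Bool := canonPairFn canonF (canonPairFn canonF canonPathFn)

/-- `canonDrawnEdgeFn ∈ FP`. [folklore] -/
theorem canonDrawnEdgeFn_mem_FP : canonDrawnEdgeFn ∈ FP :=
  canonPairFn_mem_FP canonF_mem_FP (canonPairFn_mem_FP canonF_mem_FP canonPathFn_mem_FP)

/-- The decoder of the inner pair `(j, π)`. [folklore] -/
theorem decode_natPath (u : List Bool) :
    (encodingNatBool.pairBool encodingGridPoint.listBool).decode u =
      some (decodeNat (boolUnpair u).1, decWalk (boolUnpair u).2) ∧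
    canonPairFn canonF canonPathFn u =
      (encodingNatBool.pairBool encodingGridPoint.listBool).encode (decodeNat (boolUnpair u).1, decWalk (boolUnpair u).2) :=
  canonPairFn_eq _ _ decodeNat decWalk (fun _ => rfl) decode_pointList canonF_eq_encodeNat_decodeNat canonPathFn_eq u

/-- The drawn-edge decoder is total with value `decDrawnEdge`, and `canonDrawnEdgeFn` re-encodes.
[folklore] -/
theorem decode_drawnEdge (u : List Bool) :
    encodingDrawnEdge.decode u = some (decDrawnEdge u) ∧ canonDrawnEdgeFn u = encodingDrawnEdge.encode (decDrawnEdge u) :=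
  canonPairFn_eq _ _ decodeNat (fun v => (decodeNat (boolUnpair v).1, decWalk (boolUnpair v).2)) (fun _ => rfl)
    (fun v => (decode_natPath v).1) canonF_eq_encodeNat_decodeNat (fun v => (decode_natPath v).2) u

/-- `|canonF u| ≤ 1 |u| + 1`. [folklore] -/
theorem length_canonF_le' (u : List Bool) : (canonF u).length ≤ 1 * u.length + 1 := by
  have := length_canonF_le u; omega

/-- `|canonDrawnEdgeFn u| ≤ 22 |u| + 10`. [folklore] -/
theorem length_canonDrawnEdgeFn_le (u : List Bool) : (canonDrawnEdgeFn u).length ≤ 22 * u.length + 10 := by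
  have hinner : ∀ v, (canonPairFn canonF canonPathFn v).length ≤ (1 + 20) * v.length + (2 * 1 + 2 + 2) := fun v =>
    length_canonPairFn_le_linear length_canonF_le' length_canonPathFn_le v
  have := length_canonPairFn_le_linear length_canonF_le' hinner u
  rw [canonDrawnEdgeFn]; omega

/-! ### Lists of drawn edges and the instance -/

/-- The list of drawn edges read off any string. [folklore] -/
def decDrawnEdgeList (u : List Bool) : List DrawnEdge := NegCNF.decList decDrawnEdge (boolUnpair u).1.length (boolUnpair u).2

/-- **Canonicalisation of drawn-edge-list codes** (a nested list: clipped loop). [folklore] -/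
def canonDrawnEdgeListFn : List Bool → List Bool := canonListFnC 32 canonDrawnEdgeFn

/-- `canonDrawnEdgeListFn ∈ FP`. [folklore] -/
theorem canonDrawnEdgeListFn_mem_FP : canonDrawnEdgeListFn ∈ FP := canonListFnC_mem_FP 32 canonDrawnEdgeFn_mem_FP

/-- The drawn-edge-list decoder is total with value `decDrawnEdgeList`, and `canonDrawnEdgeListFn`
re-encodes. [folklore] -/
theorem decode_drawnEdgeList (u : List Bool) :
    encodingDrawnEdge.listBool.decode u = some (decDrawnEdgeList u) ∧
      canonDrawnEdgeListFn u = encodingDrawnEdge.listBool.encode (decDrawnEdgeList u) :=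
  canonListFnC_eq _ decDrawnEdge (fun v => (decode_drawnEdge v).1) (fun v => (decode_drawnEdge v).2)
    length_canonDrawnEdgeFn_le (by norm_num) u

/-- The drawn-graph instance `(P, D, s, t)` read off any string. [folklore] -/
def decDrawnGraph (w : List Bool) : DrawnGraphInstance :=
  (decWalk (boolUnpair w).1, decDrawnEdgeList (boolUnpair (boolUnpair w).2).1,
    decodeNat (boolUnpair (boolUnpair (boolUnpair w).2).2).1, decodeNat (boolUnpair (boolUnpair (boolUnpair w).2).2).2)

/-- **Canonicalisation of drawn-graph instance codes.** [folklore] -/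
def canonDrawnGraphFn : List Bool → List Bool :=
  canonPairFn canonPathFn (canonPairFn canonDrawnEdgeListFn (canonPairFn canonF canonF))

/-- **`canonDrawnGraphFn ∈ FP`.** [cite: AroraBarak2009, §1.3] -/
theorem canonDrawnGraphFn_mem_FP : canonDrawnGraphFn ∈ FP :=
  canonPairFn_mem_FP canonPathFn_mem_FP (canonPairFn_mem_FP canonDrawnEdgeListFn_mem_FP
    (canonPairFn_mem_FP canonF_mem_FP canonF_mem_FP))

/-- The decoder of the index pair `(s, t)`. [folklore] -/
theorem decode_natNat (u : List Bool) :
    (encodingNatBool.pairBool encodingNatBool).decode u = some (decodeNat (boolUnpair u).1, decodeNat (boolUnpair u).2) ∧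
      canonPairFn canonF canonF u =
        (encodingNatBool.pairBool encodingNatBool).encode (decodeNat (boolUnpair u).1, decodeNat (boolUnpair u).2) :=
  canonPairFn_eq _ _ decodeNat decodeNat (fun _ => rfl) (fun _ => rfl) canonF_eq_encodeNat_decodeNat canonF_eq_encodeNat_decodeNat u

/-- The decoder of `(D, (s, t))`. [folklore] -/
theorem decode_edgesNatNat (u : List Bool) :
    (encodingDrawnEdge.listBool.pairBool (encodingNatBool.pairBool encodingNatBool)).decode u =
      some (decDrawnEdgeList (boolUnpair u).1, decodeNat (boolUnpair (boolUnpair u).2).1, decodeNat (boolUnpair (boolUnpair u).2).2) ∧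
    canonPairFn canonDrawnEdgeListFn (canonPairFn canonF canonF) u =
      (encodingDrawnEdge.listBool.pairBool (encodingNatBool.pairBool encodingNatBool)).encode
        (decDrawnEdgeList (boolUnpair u).1, decodeNat (boolUnpair (boolUnpair u).2).1, decodeNat (boolUnpair (boolUnpair u).2).2) :=
  canonPairFn_eq _ _ decDrawnEdgeList (fun v => (decodeNat (boolUnpair v).1, decodeNat (boolUnpair v).2))
    (fun v => (decode_drawnEdgeList v).1) (fun v => (decode_natNat v).1) (fun v => (decode_drawnEdgeList v).2)
    (fun v => (decode_natNat v).2) u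

/-- **The drawn-graph decoder is total** with value `decDrawnGraph`, and **`canonDrawnGraphFn`
re-encodes**: `canonDrawnGraphFn w = encode (decDrawnGraph w)`. [cite: AroraBarak2009, §0.1] -/
theorem decode_drawnGraph (w : List Bool) :
    encodingDrawnGraphInstance.decode w = some (decDrawnGraph w) ∧
      canonDrawnGraphFn w = encodingDrawnGraphInstance.encode (decDrawnGraph w) :=
  canonPairFn_eq _ _ decWalk (fun v => (decDrawnEdgeList (boolUnpair v).1, decodeNat (boolUnpair (boolUnpair v).2).1,
      decodeNat (boolUnpair (boolUnpair v).2).2)) decode_pointList (fun v => (decode_edgesNatNat v).1) canonPathFn_eq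
    (fun v => (decode_edgesNatNat v).2) w

/-- `decDrawnGraph` inverts the instance code. [folklore] -/
theorem decDrawnGraph_encode (i : DrawnGraphInstance) : decDrawnGraph (encodingDrawnGraphInstance.encode i) = i := by
  have h := (decode_drawnGraph (encodingDrawnGraphInstance.encode i)).1
  rw [encodingDrawnGraphInstance.decode_encode] at h
  exact (Option.some.inj h).symm

/-- **`GRIDHAMPATHCOUNT` through the total decoder**: on every string it is the count of the
decoded instance (or `0` if that is not a valid presentation). [folklore] -/
theorem GRIDHAMPATHCOUNT_eq (w : List Bool) :
    GRIDHAMPATHCOUNT w = (let i := decDrawnGraph w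
      if IsGridDrawing i.1 i.2.1 ∧ i.2.2.1 < i.1.length ∧ i.2.2.2 < i.1.length then hamPathCount i.1.length i.2.1 i.2.2.1 i.2.2.2
      else 0) := by
  classical
  rw [GRIDHAMPATHCOUNT, (decode_drawnGraph w).1]

end Literature.Barriers.CriticalPhenomena.GridSAW
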